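import Summits.QuantumFields.BalabanUV.Beta.EriceRemainderEnclosureHistoryAutonomyOrder
import Summits.QuantumFields.BalabanUV.Beta.EriceRemainderEnclosureHistoryAutonomyThresholdWellPosed

/-!
# EriceRemainderEnclosureHistoryAutonomyOrderMarkov — (E48b) BELOW THE THRESHOLD THE MEMORY IS INVISIBLE ON THE SOLUTION FAMILY: in every uniqueness
# regime the flow with memory `1∕h(m+1)² = 1∕h(m)² + B(h(m+1), h(m+2), …)` has EXACTLY the same box solutions, from every pin of ]0,γ], as the MARKOV flow
# `1∕h(m+1)² = 1∕h(m)² + Φ_B(h(m+1))` of its EFFECTIVE β-FUNCTION `Φ_B(a) = B(S a)` — the functional evaluated on the solution from the pin `a`; `Φ_B` is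
# continuous on ]0,γ] with the floor `b` and the bound `B(γ,γ,…) + M·γ`, Lipschitz with (E38b)'s constant below the open threshold, and its scale function
# `a ↦ 1∕a² − Φ_B(a)` is STRICTLY DECREASING on the reachable range (node U2's one-step injectivity of `memFlow_unique_of_markov`, earned rather than assumed)

Cell `pub-balaban`, β-function sub-cell, BINDER row D4 «RemainderConst leaves for Bałaban's split» (`HOME/BINDER-OWNERS.md`; owner lineage `b2b-balaban-beta-an4`;
this file by co-owner #2 lineage `b2b-balaban-beta-d4-p2`, generation 45), β-FLOW TEAM duty (1), FREEZE (0) honoured (def-free: the effective β-function is the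
explicit expression `fun a => B (S a)` for a family `S` of box solutions, never a `def`; node U2's `MemFlow` ∕ `SeqBox`, (E38b)'s `memFlow_stability_zs`, (E48a)'s
family lemmas BY NAME).  Sequel of (E48a) `…HistoryAutonomyOrder` (imported: `family_tail_eq`, `family_succ_eq`, `family_zero`, `family_mem`, `tendsto_family`,
`strictMonoOn_oneStep`, `le_upper_of_zm`) and (E38b) `…HistoryAutonomyThresholdWellPosed` (imported for §1's Lipschitz bound only).

HONEST FRAMING (page 1, verbatim and binding).  *"Discharging BetaPertH makes Bałaban's UV stability UNCONDITIONAL — a real constructive-QFT result; it is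
NOT the continuum limit and NOT the Clay problem."*  THIS FILE DISCHARGES NOTHING OF THE KIND.  Pure real analysis about an ABSTRACT functional `B : (ℕ → ℝ) → ℝ`
with displayed zeroth moment `M` and floor `b` on ]0,γ]^ℕ and an abstract family of box solutions — hypotheses, not facts.  AS-PRINTED: Erice p. 249 records a
MARKOV `β_n(g²)` and THE CLAIM of pointwise convergence (`BetaFlowAsPrinted.Conclusions.c369claim`; DELTA D-11); [I] p. 298 says only that `β_{k+1}` depends on the
preceding couplings.  This file says: IF the limit flow with memory is in a uniqueness regime, THEN a Markov β-function with the same trajectories exists — a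
statement about the tree's binder shapes, not about Bałaban's (1.22), whose modulus and side of the threshold are NOT PRINTED (GAPS G-t4-U2-1∕-2).  Row D4 class
UNCHANGED (critical-path width 0; instance 0∕1; D4 DISCHARGE NO DATE).  HONEST DEPENDENCY: continuum YM on T⁴ ⇐ BetaPertH ∧ nine spine estimates (0/9 proved);
BetaPertH ⇐ (D1) ∧ (D4) ∧ CAP+tail; G-an2-4 gates asym, D1 and NE2/3/4.

THE POINT (census sense (α); the AUTONOMY row — what the memory costs at the level of trajectories).  (E37a) identified the continuum flow with the memory
flow of ONE functional `B`; (E37b)–(E47) priced the memory (threshold `3√3`, modulus).  (E48a) showed that under uniqueness the solution family is generated by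
one strictly increasing continuous one-step map `f : p ↦ S p 1`, `S p j = f^[j] p`.  Read backwards this says the memory flow IS Markov on its solutions: along
a solution the memory term at scale `m` is `B(h(m+1), h(m+2), …) = B(S (h(m+1))) = Φ_B(h(m+1))` (the tail is the solution from its own value), so `h` solves the
MARKOV flow of `Φ_B = B ∘ S` (§2 `memFlow_effective`); conversely a box solution `k` of the Markov flow of `Φ_B` from `t` IS `S t` (§2 `eq_family_of_memFlow_effective`:
splice `(k n, S (k (n+1)))` into a memory solution from `k n`, uniqueness gives `k (n+1) = f (k n)`, then iterate) — so the two flows have the SAME solution set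
from every pin (`memFlow_iff_memFlow_effective`, `existsUnique_memFlow_effective`).  §1: `Φ_B` has the floor `b`, the bound `B(γ,…) + M·γ`, is CONTINUOUS on ]0,γ]
((E48a)'s uniform-in-age continuity of `S` + the zeroth moment) and LIPSCHITZ below the open threshold, `|Φ_B p − Φ_B p′| ≤ M·γ³∕2·|1∕p² − 1∕p′²|∕(1 − q)`
((E38b), `η = 0`).  §3: the effective scale function `ψ(a) = 1∕a² − Φ_B(a)` satisfies `ψ(f p) = 1∕p²` and is STRICTLY DECREASING on the reachable range `f(]0,γ])` — node
U2's Markov injectivity hypothesis (`memFlow_unique_of_markov`'s `hinj`) holds there as a CONSEQUENCE of uniqueness of the memory flow.  §4 instance: a Markov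
functional `u ↦ φ(u 0)` with `φ` Lipschitz, a floor, and node U2's one-step injectivity is a uniqueness regime, hence ORDERED ((E48a) `lt_of_pin_lt`).  Census
reading: in a uniqueness regime the as-printed MARKOV currency loses NO trajectory of the memory flow — what the memory decides is only WHICH Markov function
(`Φ_B` needs the whole solution from each pin) and WHETHER the regime is one of uniqueness ((E38c)∕(E48d): above `3√3` it need not be).  NOT claimed: that `Φ_B`
is `B`'s Markov part `a ↦ B(a, 0, 0, …)` or any printed `β(g²)`; injectivity of `ψ` outside the reachable range; anything about Bałaban's (1.22).

WHAT IS PROVED ([folklore]; 0 `def`, 0 sorry).  §1 `floor_effective`, `effective_le_upper`, **`continuousOn_effective`**, **`abs_effective_sub_le_zs`** (Lipschitz, `M·γ < 3√3·b`).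
§2 **`memFlow_effective`**, `splice_memFlow`, **`succ_eq_oneStep_of_memFlow_effective`**, **`eq_family_of_memFlow_effective`**, **`memFlow_iff_memFlow_effective`**,
**`existsUnique_memFlow_effective`**.  §3 `effective_scale_eq`, **`strictAntiOn_effective_scale`**, `injOn_effective_scale`, **`image_oneStep`** (the range of the one-step map is ]0, S γ 1]),
**`strictAntiOn_effective_scale_Ioc`**, `hinj_effective` (node U2's `hinj` on ]0, S γ 1]).  §4 **`lt_of_pin_lt_of_markov`**.
-/

noncomputable section
open Filter Topology Finset Set

namespace Summit.QuantumFields.BalabanUV.Beta.EriceRemainderEnclosureHistoryAutonomyOrderMarkov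

open Literature.MathematicalPhysics.QuantumFieldTheory.Balaban1983to89
open Literature.MathematicalPhysics.QuantumFieldTheory.Balaban1983to89.T4BetaStationary
open Literature.MathematicalPhysics.QuantumFieldTheory.Balaban1983to89.T4BetaFlowWellPosed
open Literature.MathematicalPhysics.QuantumFieldTheory.Balaban1983to89.T4BetaFlowWellPosed.Sharpness (memFlow_unique_of_markov)
open Summit.QuantumFields.BalabanUV.Beta.EriceRemainderEnclosureHistoryAutonomyThresholdWellPosed (memFlow_stability_zs)
open Summit.QuantumFields.BalabanUV.Beta.EriceRemainderEnclosureHistoryAutonomyOrder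

variable {B : (ℕ → ℝ) → ℝ} {M γ b : ℝ} {h : ℕ → ℝ} {S : ℝ → ℕ → ℝ}

/-! ## §1 The effective β-function `a ↦ B (S a)`: floor, bound, continuity, Lipschitz below the open threshold -/

/-- The effective β-function inherits the FLOOR: `b ≤ B (S a)`. [folklore] -/
theorem floor_effective (hlo : ∀ u, SeqBox γ u → b ≤ B u) (hS : ∀ p, 0 < p → p ≤ γ → SeqBox γ (S p) ∧ MemFlow B p (S p))
    {a : ℝ} (ha0 : 0 < a) (haγ : a ≤ γ) : b ≤ B (S a) :=
  hlo _ (hS a ha0 haγ).1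

/-- … and the UPPER VALUE of the zeroth moment: `B (S a) ≤ B(γ, γ, …) + M·γ`. [folklore] -/
theorem effective_le_upper
    (hB : ∀ u u' : ℕ → ℝ, SeqBox γ u → SeqBox γ u' → ∀ D : ℝ, (∀ j, |u j - u' j| ≤ D) → |B u - B u'| ≤ M * D)
    (hS : ∀ p, 0 < p → p ≤ γ → SeqBox γ (S p) ∧ MemFlow B p (S p)) {a : ℝ} (ha0 : 0 < a) (haγ : a ≤ γ) :
    B (S a) ≤ B (fun _ => γ) + M * γ :=
  le_upper_of_zm hB (ha0.trans_le haγ) _ (hS a ha0 haγ).1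

/-- **THE EFFECTIVE β-FUNCTION IS CONTINUOUS ON ]0,γ]** in every uniqueness regime: `S` is continuous in the pin UNIFORMLY in the age ((E48a) `tendsto_family`)
and `B` is `M`-Lipschitz for the uniform distance on the box. [folklore] -/
theorem continuousOn_effective (hb : 0 < b) (hγ : 0 < γ)
    (hB : ∀ u u' : ℕ → ℝ, SeqBox γ u → SeqBox γ u' → ∀ D : ℝ, (∀ j, |u j - u' j| ≤ D) → |B u - B u'| ≤ M * D)
    (hM : 0 ≤ M) (hlo : ∀ u, SeqBox γ u → b ≤ B u)
    (hS : ∀ p, 0 < p → p ≤ γ → SeqBox γ (S p) ∧ MemFlow B p (S p))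
    (huniq : ∀ p, 0 < p → p ≤ γ → ∀ u u' : ℕ → ℝ, SeqBox γ u → SeqBox γ u' → MemFlow B p u → MemFlow B p u' → u = u') :
    ContinuousOn (fun a => B (S a)) (Ioc 0 γ) := by
  intro p hp
  rw [ContinuousWithinAt, tendsto_iff_seq_tendsto]
  intro g hg
  rw [tendsto_nhdsWithin_iff] at hg
  set g' : ℕ → ℝ := fun n => if p / 2 ≤ g n ∧ g n ≤ γ then g n else p with hg'
  have hgb : ∀ n, p / 2 ≤ g' n ∧ g' n ≤ γ := by
    intro n
    by_cases hc : p / 2 ≤ g n ∧ g n ≤ γ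
    · simp only [hg', hc, and_self, if_true]
    · simp only [hg', hc, if_false]; exact ⟨by linarith [hp.1], hp.2⟩
  have hg0 : ∀ n, 0 < g' n ∧ g' n ≤ γ := fun n => ⟨(by linarith [hp.1] : 0 < p / 2).trans_le (hgb n).1, (hgb n).2⟩
  have hev : ∀ᶠ n in atTop, g' n = g n := by
    have h1 : ∀ᶠ n in atTop, p / 2 < g n := (tendsto_order.1 hg.1).1 _ (by linarith [hp.1])
    filter_upwards [h1, hg.2] with n hn1 hn2
    simp only [hg', hn1.le, hn2.2, and_self, if_true]
  have hg't : Tendsto g' atTop (𝓝 p) := hg.1.congr' (hev.mono fun n hn => hn.symm)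
  have hunif := (tendsto_family hb hγ hB hM hlo hS huniq hp hgb hg't).2
  have hlim : Tendsto (fun n => B (S (g' n))) atTop (𝓝 (B (S p))) := by
    rw [Metric.tendsto_nhds]
    intro ε hε
    have hε' : 0 < ε / (M + 1) := div_pos hε (by linarith)
    filter_upwards [hunif (ε / (M + 1)) hε'] with n hn
    rw [Real.dist_eq]
    calc |B (S (g' n)) - B (S p)| ≤ M * (ε / (M + 1)) :=
          hB _ _ (hS _ (hg0 n).1 (hg0 n).2).1 (hS p hp.1 hp.2).1 _ hn
      _ < ε := by
          rw [mul_div_assoc']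
          rw [div_lt_iff₀ (by linarith)]
          nlinarith
  refine hlim.congr' ?_
  filter_upwards [hev] with n hn
  simp only [Function.comp, hn]

/-- **LIPSCHITZ BELOW THE OPEN THRESHOLD**: for `M·γ < 3√3·b`, `|B (S p) − B (S p′)| ≤ M·(γ³∕2·|1∕p² − 1∕p′²|)∕(1 − M·γ∕(3√3·b))` — (E38b)'s Lipschitz dependence of
the solution on the pin, uniformly in the age, composed with the zeroth moment. [folklore] -/
theorem abs_effective_sub_le_zs
    (hB : ∀ u u' : ℕ → ℝ, SeqBox γ u → SeqBox γ u' → ∀ D : ℝ, (∀ j, |u j - u' j| ≤ D) → |B u - B u'| ≤ M * D)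
    (hM : 0 ≤ M) (hb : 0 < b) (hlo : ∀ u, SeqBox γ u → b ≤ B u) (hsmall : M * γ < 3 * Real.sqrt 3 * b)
    (hS : ∀ p, 0 < p → p ≤ γ → SeqBox γ (S p) ∧ MemFlow B p (S p)) {p p' : ℝ} (hp : p ∈ Ioc 0 γ) (hp' : p' ∈ Ioc 0 γ) :
    |B (S p) - B (S p')| ≤ M * (γ ^ 3 / 2 * |1 / p ^ 2 - 1 / p' ^ 2| / (1 - M * γ / (3 * Real.sqrt 3 * b))) := by
  refine hB _ _ (hS p hp.1 hp.2).1 (hS p' hp'.1 hp'.2).1 _ fun m => ?_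
  have h := memFlow_stability_zs (B' := B) hB hM hp.1 hp.2 hp'.1 hp'.2 hb hlo hlo hsmall (η := 0) (fun u _ => by simp)
    (hS p hp.1 hp.2).1 (hS p' hp'.1 hp'.2).1 (hS p hp.1 hp.2).2 (hS p' hp'.1 hp'.2).2 m
  simpa only [mul_zero, add_zero] using h

/-! ## §2 THE EQUIVALENCE: memory flow and effective Markov flow have the same box solutions from every pin -/

/-- **EVERY BOX SOLUTION OF THE MEMORY FLOW SOLVES THE EFFECTIVE MARKOV FLOW**: along a solution from `t ∈ ]0,γ]` the memory term at scale `m` is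
`B(h(m+1), h(m+2), …) = B(S (h(m+1)))` — the tail is THE solution from its own value. [folklore] -/
theorem memFlow_effective (hS : ∀ p, 0 < p → p ≤ γ → SeqBox γ (S p) ∧ MemFlow B p (S p))
    (huniq : ∀ p, 0 < p → p ≤ γ → ∀ u u' : ℕ → ℝ, SeqBox γ u → SeqBox γ u' → MemFlow B p u → MemFlow B p u' → u = u')
    {t : ℝ} (ht : t ∈ Ioc 0 γ) (hh : SeqBox γ h) (hf : MemFlow B t h) : MemFlow (fun u => B (S (u 0))) t h := by
  refine ⟨hf.1, fun m => ?_⟩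
  have e : h = S t := huniq t ht.1 ht.2 _ _ hh (hS t ht.1 ht.2).1 hf (hS t ht.1 ht.2).2
  have htail : (fun j => h (m + 1 + j)) = S (h (m + 1)) := by
    rw [e]; exact family_tail_eq hS huniq ht.1 ht.2 (m + 1)
  show 1 / h (m + 1) ^ 2 = 1 / h m ^ 2 + B (S (h (m + 1 + 0)))
  rw [add_zero, ← htail]
  exact hf.2 m

/-- THE SPLICE: for a box solution `k` of the effective Markov flow, the history `(k n, S (k(n+1)) 0, S (k(n+1)) 1, …)` is a box solution of the MEMORY flow
from the pin `k n` — its scale-0 equation is `k`'s Markov equation at scale `n`, its higher equations are those of `S (k (n+1))`. [folklore] -/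
theorem splice_memFlow (hS : ∀ p, 0 < p → p ≤ γ → SeqBox γ (S p) ∧ MemFlow B p (S p))
    {t : ℝ} {k : ℕ → ℝ} (hk : SeqBox γ k) (hfk : MemFlow (fun u => B (S (u 0))) t k) (n : ℕ) :
    SeqBox γ (fun j => if j = 0 then k n else S (k (n + 1)) (j - 1)) ∧
      MemFlow B (k n) (fun j => if j = 0 then k n else S (k (n + 1)) (j - 1)) := by
  have hkn1 : k (n + 1) ∈ Ioc 0 γ := ⟨(hk (n + 1)).1, (hk (n + 1)).2⟩
  have hSk := hS _ hkn1.1 hkn1.2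
  have hvs : ∀ j : ℕ, (fun j => if j = 0 then k n else S (k (n + 1)) (j - 1)) (j + 1) = S (k (n + 1)) j := fun j => by
    simp only [Nat.add_one_ne_zero, if_false, Nat.add_sub_cancel]
  refine ⟨fun j => ?_, ⟨by simp, fun m => ?_⟩⟩
  · cases j with
    | zero => simpa using hk n
    | succ j => rw [hvs]; exact hSk.1 j
  · cases m with
    | zero =>
      have e1 : (fun j => (fun j => if j = 0 then k n else S (k (n + 1)) (j - 1)) (0 + 1 + j)) = S (k (n + 1)) :=
        funext fun j => by rw [zero_add, Nat.add_comm 1 j]; exact hvs j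
      rw [e1, show (0 : ℕ) + 1 = 1 from rfl, hvs 0, hSk.2.1]
      have := hfk.2 n
      simp only [add_zero] at this
      simpa using this
    | succ m =>
      have e1 : (fun j => (fun j => if j = 0 then k n else S (k (n + 1)) (j - 1)) (m + 1 + 1 + j)) =
          fun j => S (k (n + 1)) (m + 1 + j) :=
        funext fun j => by rw [show m + 1 + 1 + j = (m + 1 + j) + 1 by omega]; exact hvs _
      rw [e1, hvs (m + 1), hvs m]
      exact hSk.2.2 m

/-- **A BOX SOLUTION OF THE EFFECTIVE MARKOV FLOW ADVANCES BY THE ONE-STEP MAP**: `k (n+1) = S (k n) 1` — the splice is THE memory solution from `k n`.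
[folklore] -/
theorem succ_eq_oneStep_of_memFlow_effective (hS : ∀ p, 0 < p → p ≤ γ → SeqBox γ (S p) ∧ MemFlow B p (S p))
    (huniq : ∀ p, 0 < p → p ≤ γ → ∀ u u' : ℕ → ℝ, SeqBox γ u → SeqBox γ u' → MemFlow B p u → MemFlow B p u' → u = u')
    {t : ℝ} {k : ℕ → ℝ} (hk : SeqBox γ k) (hfk : MemFlow (fun u => B (S (u 0))) t k) (n : ℕ) : k (n + 1) = S (k n) 1 := by
  have hkn : k n ∈ Ioc 0 γ := ⟨(hk n).1, (hk n).2⟩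
  have hkn1 : k (n + 1) ∈ Ioc 0 γ := ⟨(hk (n + 1)).1, (hk (n + 1)).2⟩
  obtain ⟨hvbox, hvflow⟩ := splice_memFlow hS hk hfk n
  have hv := huniq (k n) hkn.1 hkn.2 _ _ hvbox (hS _ hkn.1 hkn.2).1 hvflow (hS _ hkn.1 hkn.2).2
  have h1 := congrFun hv 1
  simp only [one_ne_zero, if_false, Nat.sub_self] at h1
  rw [family_zero hS hkn1.1 hkn1.2] at h1
  exact h1

/-- **EVERY BOX SOLUTION OF THE EFFECTIVE MARKOV FLOW IS THE MEMORY SOLUTION**: `k = S t`. [folklore] -/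
theorem eq_family_of_memFlow_effective (hS : ∀ p, 0 < p → p ≤ γ → SeqBox γ (S p) ∧ MemFlow B p (S p))
    (huniq : ∀ p, 0 < p → p ≤ γ → ∀ u u' : ℕ → ℝ, SeqBox γ u → SeqBox γ u' → MemFlow B p u → MemFlow B p u' → u = u')
    {t : ℝ} (ht : t ∈ Ioc 0 γ) {k : ℕ → ℝ} (hk : SeqBox γ k) (hfk : MemFlow (fun u => B (S (u 0))) t k) : k = S t := by
  funext n
  induction n with
  | zero => rw [hfk.1, family_zero hS ht.1 ht.2]
  | succ n ih => rw [succ_eq_oneStep_of_memFlow_effective hS huniq hk hfk n, ih, ← family_succ_eq hS huniq ht.1 ht.2 n]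

/-- **THE EQUIVALENCE**: in a uniqueness regime a box history solves the flow with memory of `B` from `t` IFF it solves the Markov flow of the effective
β-function `a ↦ B (S a)` from `t`. [folklore] -/
theorem memFlow_iff_memFlow_effective (hS : ∀ p, 0 < p → p ≤ γ → SeqBox γ (S p) ∧ MemFlow B p (S p))
    (huniq : ∀ p, 0 < p → p ≤ γ → ∀ u u' : ℕ → ℝ, SeqBox γ u → SeqBox γ u' → MemFlow B p u → MemFlow B p u' → u = u')
    {t : ℝ} (ht : t ∈ Ioc 0 γ) (hh : SeqBox γ h) : MemFlow B t h ↔ MemFlow (fun u => B (S (u 0))) t h := by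
  refine ⟨memFlow_effective hS huniq ht hh, fun hfk => ?_⟩
  rw [eq_family_of_memFlow_effective hS huniq ht hh hfk]
  exact (hS t ht.1 ht.2).2

/-- Hence the effective Markov flow has EXACTLY ONE box solution from every pin of ]0,γ], namely `S t`. [folklore] -/
theorem existsUnique_memFlow_effective (hS : ∀ p, 0 < p → p ≤ γ → SeqBox γ (S p) ∧ MemFlow B p (S p))
    (huniq : ∀ p, 0 < p → p ≤ γ → ∀ u u' : ℕ → ℝ, SeqBox γ u → SeqBox γ u' → MemFlow B p u → MemFlow B p u' → u = u')
    {t : ℝ} (ht : t ∈ Ioc 0 γ) : ∃! k : ℕ → ℝ, SeqBox γ k ∧ MemFlow (fun u => B (S (u 0))) t k :=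
  ⟨S t, ⟨(hS t ht.1 ht.2).1, memFlow_effective hS huniq ht (hS t ht.1 ht.2).1 (hS t ht.1 ht.2).2⟩,
    fun _ hk => eq_family_of_memFlow_effective hS huniq ht hk.1 hk.2⟩

/-! ## §3 The effective scale function `a ↦ 1∕a² − B (S a)` is strictly decreasing on the reachable range -/

/-- THE SCALE-0 EQUATION in effective form: `1∕(S p 1)² − B (S (S p 1)) = 1∕p²`. [folklore] -/
theorem effective_scale_eq (hS : ∀ p, 0 < p → p ≤ γ → SeqBox γ (S p) ∧ MemFlow B p (S p))
    (huniq : ∀ p, 0 < p → p ≤ γ → ∀ u u' : ℕ → ℝ, SeqBox γ u → SeqBox γ u' → MemFlow B p u → MemFlow B p u' → u = u')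
    {p : ℝ} (hp : p ∈ Ioc 0 γ) : 1 / (S p 1) ^ 2 - B (S (S p 1)) = 1 / p ^ 2 := by
  have h0 := (hS p hp.1 hp.2).2.2 0
  rw [family_zero hS hp.1 hp.2] at h0
  simp only [zero_add] at h0
  rw [family_tail_eq hS huniq hp.1 hp.2 1] at h0
  linarith

/-- **THE EFFECTIVE SCALE FUNCTION IS STRICTLY DECREASING ON THE REACHABLE RANGE** `(p ↦ S p 1) '' ]0,γ]`: there `1∕a² − B(S a)` is `1∕p²` at `a = S p 1`, and
`p ↦ S p 1` is strictly increasing ((E48a) `strictMonoOn_oneStep`). [folklore] -/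
theorem strictAntiOn_effective_scale (hb : 0 < b) (hγ : 0 < γ)
    (hB : ∀ u u' : ℕ → ℝ, SeqBox γ u → SeqBox γ u' → ∀ D : ℝ, (∀ j, |u j - u' j| ≤ D) → |B u - B u'| ≤ M * D)
    (hM : 0 ≤ M) (hlo : ∀ u, SeqBox γ u → b ≤ B u)
    (hS : ∀ p, 0 < p → p ≤ γ → SeqBox γ (S p) ∧ MemFlow B p (S p))
    (huniq : ∀ p, 0 < p → p ≤ γ → ∀ u u' : ℕ → ℝ, SeqBox γ u → SeqBox γ u' → MemFlow B p u → MemFlow B p u' → u = u') :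
    StrictAntiOn (fun a => 1 / a ^ 2 - B (S a)) ((fun p => S p 1) '' Ioc 0 γ) := by
  rintro _ ⟨p, hp, rfl⟩ _ ⟨p', hp', rfl⟩ hlt
  have hpp' : p < p' := ((strictMonoOn_oneStep hb hγ hB hM hlo hS huniq).lt_iff_lt hp hp').1 hlt
  show 1 / (S p' 1) ^ 2 - B (S (S p' 1)) < 1 / (S p 1) ^ 2 - B (S (S p 1))
  rw [effective_scale_eq hS huniq hp, effective_scale_eq hS huniq hp']
  exact one_div_lt_one_div_of_lt (pow_pos hp.1 2) (pow_lt_pow_left₀ hpp' hp.1.le two_ne_zero)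

/-- Hence node U2's one-step injectivity (`memFlow_unique_of_markov`'s `hinj`) holds for the effective β-function ON THE REACHABLE RANGE — earned from the
uniqueness of the memory flow, not assumed. [folklore] -/
theorem injOn_effective_scale (hb : 0 < b) (hγ : 0 < γ)
    (hB : ∀ u u' : ℕ → ℝ, SeqBox γ u → SeqBox γ u' → ∀ D : ℝ, (∀ j, |u j - u' j| ≤ D) → |B u - B u'| ≤ M * D)
    (hM : 0 ≤ M) (hlo : ∀ u, SeqBox γ u → b ≤ B u)
    (hS : ∀ p, 0 < p → p ≤ γ → SeqBox γ (S p) ∧ MemFlow B p (S p))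
    (huniq : ∀ p, 0 < p → p ≤ γ → ∀ u u' : ℕ → ℝ, SeqBox γ u → SeqBox γ u' → MemFlow B p u → MemFlow B p u' → u = u') :
    InjOn (fun a => 1 / a ^ 2 - B (S a)) ((fun p => S p 1) '' Ioc 0 γ) :=
  (strictAntiOn_effective_scale hb hγ hB hM hlo hS huniq).injOn

/-- **THE RANGE OF THE ONE-STEP MAP IS THE INTERVAL ]0, S γ 1]** — continuous, strictly increasing, squeezed to `0` by `S p 1 < p` (intermediate values on
`[min y γ, γ]`).  So the reachable range of every scale map `p ↦ S p (j+1)` lies in ]0, S γ 1]. [folklore] -/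
theorem image_oneStep (hb : 0 < b) (hγ : 0 < γ)
    (hB : ∀ u u' : ℕ → ℝ, SeqBox γ u → SeqBox γ u' → ∀ D : ℝ, (∀ j, |u j - u' j| ≤ D) → |B u - B u'| ≤ M * D)
    (hM : 0 ≤ M) (hlo : ∀ u, SeqBox γ u → b ≤ B u)
    (hS : ∀ p, 0 < p → p ≤ γ → SeqBox γ (S p) ∧ MemFlow B p (S p))
    (huniq : ∀ p, 0 < p → p ≤ γ → ∀ u u' : ℕ → ℝ, SeqBox γ u → SeqBox γ u' → MemFlow B p u → MemFlow B p u' → u = u') :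
    (fun p => S p 1) '' Ioc 0 γ = Ioc 0 (S γ 1) := by
  apply Set.Subset.antisymm
  · rintro _ ⟨p, hp, rfl⟩
    refine ⟨(family_mem hS hp.1 hp.2 1).1, ?_⟩
    rcases hp.2.eq_or_lt with heq | hlt
    · rw [heq]
    · exact (strictMonoOn_oneStep hb hγ hB hM hlo hS huniq hp ⟨hγ, le_rfl⟩ hlt).le
  · rintro y ⟨hy0, hyγ⟩
    set a : ℝ := min y γ with ha
    have ha0 : 0 < a := lt_min hy0 hγ
    have haγ : a ≤ γ := min_le_right _ _
    have hfa : S a 1 < y := (oneStep_lt hb hlo hS ha0 haγ).trans_le (min_le_left _ _)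
    have hcont : ContinuousOn (fun p => S p 1) (Icc a γ) :=
      (continuousOn_family hb hγ hB hM hlo hS huniq 1).mono fun x hx => ⟨ha0.trans_le hx.1, hx.2⟩
    obtain ⟨p, hp, hpy⟩ := intermediate_value_Icc haγ hcont ⟨hfa.le, hyγ⟩
    exact ⟨p, ⟨ha0.trans_le hp.1, hp.2⟩, hpy⟩

/-- Hence **THE EFFECTIVE SCALE FUNCTION IS STRICTLY DECREASING ON THE WHOLE INTERVAL ]0, S γ 1]** — node U2's Markov one-step injectivity
(`memFlow_unique_of_markov`'s `hinj`) holds for the effective β-function on the box ]0, S γ 1] that every ultraviolet value of every solution inhabits. [folklore] -/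
theorem strictAntiOn_effective_scale_Ioc (hb : 0 < b) (hγ : 0 < γ)
    (hB : ∀ u u' : ℕ → ℝ, SeqBox γ u → SeqBox γ u' → ∀ D : ℝ, (∀ j, |u j - u' j| ≤ D) → |B u - B u'| ≤ M * D)
    (hM : 0 ≤ M) (hlo : ∀ u, SeqBox γ u → b ≤ B u)
    (hS : ∀ p, 0 < p → p ≤ γ → SeqBox γ (S p) ∧ MemFlow B p (S p))
    (huniq : ∀ p, 0 < p → p ≤ γ → ∀ u u' : ℕ → ℝ, SeqBox γ u → SeqBox γ u' → MemFlow B p u → MemFlow B p u' → u = u') :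
    StrictAntiOn (fun a => 1 / a ^ 2 - B (S a)) (Ioc 0 (S γ 1)) := by
  rw [← image_oneStep hb hγ hB hM hlo hS huniq]
  exact strictAntiOn_effective_scale hb hγ hB hM hlo hS huniq

/-- … in node U2's `hinj` form on the box ]0, S γ 1]. [folklore] -/
theorem hinj_effective (hb : 0 < b) (hγ : 0 < γ)
    (hB : ∀ u u' : ℕ → ℝ, SeqBox γ u → SeqBox γ u' → ∀ D : ℝ, (∀ j, |u j - u' j| ≤ D) → |B u - B u'| ≤ M * D)
    (hM : 0 ≤ M) (hlo : ∀ u, SeqBox γ u → b ≤ B u)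
    (hS : ∀ p, 0 < p → p ≤ γ → SeqBox γ (S p) ∧ MemFlow B p (S p))
    (huniq : ∀ p, 0 < p → p ≤ γ → ∀ u u' : ℕ → ℝ, SeqBox γ u → SeqBox γ u' → MemFlow B p u → MemFlow B p u' → u = u') :
    ∀ x x', 0 < x → x ≤ S γ 1 → 0 < x' → x' ≤ S γ 1 →
      1 / x ^ 2 - (fun a => B (S a)) x = 1 / x' ^ 2 - (fun a => B (S a)) x' → x = x' :=
  fun _ _ hx hxγ hx' hx'γ heq => (strictAntiOn_effective_scale_Ioc hb hγ hB hM hlo hS huniq).injOn ⟨hx, hxγ⟩ ⟨hx', hx'γ⟩ heq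

/-! ## §4 Instance: Markov functionals with an injective scale function are a uniqueness regime, hence ordered -/

/-- **MARKOV FUNCTIONALS WITH NODE U2's ONE-STEP INJECTIVITY ARE ORDERED**: `B u = φ (u 0)` with `φ` `M`-Lipschitz on ]0,γ], a floor `b > 0`, and
`x ↦ 1∕x² − φ x` injective on ]0,γ] (`memFlow_unique_of_markov`'s hypothesis): pins `t < t′` give `h j < h′ j` at every scale. [folklore] -/
theorem lt_of_pin_lt_of_markov {φ : ℝ → ℝ} {h h' : ℕ → ℝ} (hb : 0 < b) (hM : 0 ≤ M)
    (hL : ∀ x x', 0 < x → x ≤ γ → 0 < x' → x' ≤ γ → |φ x - φ x'| ≤ M * |x - x'|) (hlo : ∀ x, 0 < x → x ≤ γ → b ≤ φ x)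
    (hinj : ∀ x x', 0 < x → x ≤ γ → 0 < x' → x' ≤ γ → 1 / x ^ 2 - φ x = 1 / x' ^ 2 - φ x' → x = x')
    {t t' : ℝ} (ht : 0 < t) (htt' : t < t') (ht'γ : t' ≤ γ) (hh : SeqBox γ h) (hh' : SeqBox γ h')
    (hf : MemFlow (fun u => φ (u 0)) t h) (hf' : MemFlow (fun u => φ (u 0)) t' h') (j : ℕ) : h j < h' j := by
  have hB : ∀ u u' : ℕ → ℝ, SeqBox γ u → SeqBox γ u' → ∀ D : ℝ, (∀ j, |u j - u' j| ≤ D) →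
      |(fun u => φ (u 0)) u - (fun u => φ (u 0)) u'| ≤ M * D := fun u u' hu hu' D hD =>
    (hL _ _ (hu 0).1 (hu 0).2 (hu' 0).1 (hu' 0).2).trans (mul_le_mul_of_nonneg_left (hD 0) hM)
  exact lt_of_pin_lt hb hB hM (fun u hu => hlo _ (hu 0).1 (hu 0).2)
    (fun p _ _ u u' hu hu' hfu hfu' => memFlow_unique_of_markov hinj hu hu' hfu hfu') ht htt' ht'γ hh hh' hf hf' j

end Summit.QuantumFields.BalabanUV.Beta.EriceRemainderEnclosureHistoryAutonomyOrderMarkov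

end
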